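import Literature.AlgebraicGeometry.Milne1999.SpecialLefschetzGroupOneEqUnitaryCentralizer
import Literature.AlgebraicGeometry.Milne1999.LefschetzCentraliserRosatiInvolution
import HarnessLib

/-!
# Milne 1999, Prop. 3.3 / §1: the divisor classes of a complex abelian variety are EXACTLY the `2`-vectors whose
# contraction operator lies in `End⁰(A) ⊗ ℂ` — the Néron–Severi ↔ Rosati-symmetric dictionary on the carriers

Family `hodge`, layer `Literature/AlgebraicGeometry/Milne1999`, namespace
`Literature.AlgebraicGeometry.Milne1999` (D-0022). THEOREMS and four definitions WITH BODIES (no named fact,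
no `sorry`; D-0026, net debt 0). Written for the cell `pub-hodgecm2` (COR-CM), seat `lit-milne`, binder table
`HOME/lit/milne.md` row M4, as step 1 of the discharge of the cited record
`Milne1999_specialLefschetzGroup_invariants_le` (`Milne1999/LefschetzGroup`): the degree-two input
"`(⊗²H)^{S(A)}` = the divisor classes" of Milne's Theorem 3.2, for EVERY complex abelian variety.

## Source, verbatim

J. S. Milne, *Lefschetz classes on abelian varieties*, Duke Math. J. 96 (1999) 639–675
[`paper:doi-10-1215-s0012-7094-99-09620-5`, held; PDF page = printed page − 638]:

* §1 p. 642 (p0004): "A divisor `D` on `A` defines a class `cl(D)` in `H²(A)(1)` and […] a skew-symmetric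
  pairing `e_D : V(A) × V(A) → k(1)`. When `D` is ample, `e_D` is nondegenerate, and we let `β†` denote the
  adjoint with respect to `e_D` […]. Then `β ↦ β†` is an involution of the `k`-algebra `End_k(V(A))` whose
  restriction to `End⁰(A)` is the Rosati involution defined by `D`."
* §1 Prop. 1.3 (p. 643, p0005): "the `k`-bilinear forms `ψ : V(A) × V(A) → k` such that
  `ψ(γx, y) = ψ(x, γ†y)` for all `γ ∈ C(A)` are exactly the `k`-linear combinations of the forms `e_D`";
  Remark 1.2: "the centralizer of `C(A)` in `End_k(V(A))` is `End⁰(A) ⊗_ℚ k`."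
* §3 p. 653, Prop. 3.3 with Thm. 3.2: "`(⋀²H¹(A^r))^{S(A)}` […] is the `k`-span of the divisor classes"
  (`NS(A) ⊗ k ≅ {α ∈ End⁰(A) ⊗ k | α† = α}`, Mumford §21 Application III p. 208).

## What is proved (the tree's carriers: `H¹ = H¹(A(ℂ); ℂ)`, `H² = ⋀²H¹`, `End(A)` acting by `φ^*`)

For a complex abelian variety `A` and a non-degenerate alternating scalar form `B` on `H¹(A(ℂ); ℂ)` PRESERVED
BY THE HODGE GROUP (`B = λ ∘ Q_h` for a polarization class `h` and a trivialisation `λ` of the top degree,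
`exists_hodgeInvariant_bilinForm`):

* `liftTwo`, `interiorTwo`, `derivTwo`, `contractionOp` (definitions with bodies) — linear maps out of
  `H²(A(ℂ); ℂ) = ⋀²H¹` (`HasExteriorCohomologyH1`): the interior product `ι_μ(x ∪ y) = μ(y)x − μ(x)y` (the tree's
  "contraction vectors `w_c(μ)`" of `Milne1999/LefschetzGroupCentraliserInclusion`, made canonical), the derivation
  `D_X(x ∪ y) = Xx ∪ y + x ∪ Xy`, and the **contraction operator `T_c = W_c ∘ B♭`**, `T_c(v) = ι_{B(v,·)}(c)`.
* `two_smul_eq_sum_cup_interiorTwo` (`2c = Σᵢ ι_{βᵢ}(c) ∪ bᵢ`), injectivity of `c ↦ T_c`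
  (`eq_zero_of_contractionOp_eq_zero`), `B`-symmetry of `T_c` (`bilin_contractionOp_apply`), equivariance
  `T_{⋀²u c} = u T_c u⁻¹` for isometries, and the derivation rule **`T_{D_X c} = X T_c + T_c X†`**
  (`contractionOp_derivTwo`), `D_{φ^*} c = (𝟙 + φ)^*c − c − φ^*c` (`derivTwo_pullbackOne`), so that `D_{φ^*}`
  preserves `B¹(A) ⊗ ℂ` (`derivTwo_mem_hodgeClassSpan`).
* **`contractionOp_mem_bicommutant`** — for `c ∈ B¹(A) ⊗ ℂ`, `T_c` lies in the bicommutant of the `φ^*` (= the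
  `ℂ`-span of the `φ^*`, `End⁰(A) ⊗ ℂ` acting, by the tree's `centralizer_centralizerAlgebra_eq_span_of_riemann`
  with the PROVED `deligneMilne1982_Thm_6_20_full_holds`): `T_c` commutes with `Hg(A)(ℂ)|_{H¹}` (the tree's
  `apply_one_contraction_eq_of_mem_hodgeGroup` and the `Hg`-invariance of `B`), Deligne I Prop. 3.4 + Riemann.
* **`exists_mem_hodgeClassSpan_contractionOp_eq`** — conversely, EVERY `B`-symmetric element `S` of the
  bicommutant is `T_c` for a (unique) `c ∈ B¹(A) ⊗ ℂ`. Proof (no Néron–Severi group, no dual abelian variety):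
  `J = {T_c | c ∈ B¹ ⊗ ℂ}` is a subspace of the symmetric part of the bicommutant `E`, stable under
  `T ↦ XT + TX†` for `X ∈ E` (the derivation rule and `(𝟙 + φ)^*`, `φ^*` preserve `B¹`), and contains the
  INVERTIBLE `T_{h₀}` of a polarization `h₀` (`w_{h₀}` is onto: the tree's `exists_contraction_eq`, from
  `h₀^{dim A} ≠ 0`); with `X = S T_{h₀}⁻¹ ∈ E`: `XT_{h₀} + T_{h₀}X† = 2S ∈ J`.
* **`mem_hodgeClassSpan_one_iff_contractionOp_mem_bicommutant`** — `c ∈ B¹(A) ⊗ ℂ ⟺ T_c ∈ E''`; and the form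
  used downstream, `sum_smul_cupProduct_mem_hodgeClassSpan_of_mem_bicommutant`: a `2`-vector
  `Σ_l a_l x_l ∪ y_l` whose operator `v ↦ Σ_l a_l (B(v, y_l) x_l − B(v, x_l) y_l)` commutes with `C(A) ⊗ ℂ` is a
  divisor class.

## References

* [Milne1999LefschetzClasses] J. S. Milne, Lefschetz classes on abelian varieties, Duke Math. J. 96 (1999)
  639–675: §1 pp. 642–644 (e_D, †, C(A), Prop. 1.3, Remark 1.2), §3 Prop. 3.3, Thm. 3.2 (p. 653).
* [MumfordAV1970] D. Mumford, Abelian Varieties (1970), §20 Thm. 1, §21 Application III (p. 208).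
* [Deligne1982HodgeCycles] P. Deligne, Hodge cycles on abelian varieties, LNM 900 (1982), I §3 Prop. 3.4, §5.
* [DeligneMilne1982Tannakian] P. Deligne, J. S. Milne, Tannakian categories, LNM 900 (1982), II Thm. 6.20.
* [LangeBirkenhake1992] H. Lange, Ch. Birkenhake, Complex Abelian Varieties (1992), Lemma 1.1.17, §1.2,
  Prop. 5.2.1 (NS ≅ symmetric endomorphisms).
* [HatcherAT2002] A. Hatcher, Algebraic Topology (2002), §3.2 Prop. 3.10, Thm. 3.11.
-/

noncomputable section

open CategoryTheory
open Literature.AlgebraicTopology.SingularHomology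
open Literature.AlgebraicGeometry.HodgeTheory
open Literature.AlgebraicGeometry.Motives
open Literature.AlgebraicGeometry.VanGeemen1994 (pullbackOne hodgeGroupOne mem_hodgeGroupOne_iff hodgeClassSpan)

namespace Literature.AlgebraicGeometry.Milne1999

/-! ### §0 Alternating maps in two variables from bilinear maps -/

section AltTwo

variable {K V N : Type*} [CommRing K] [AddCommGroup V] [Module K V] [AddCommGroup N] [Module K N]

/-- The alternating map `(v₀, v₁) ↦ g(v₀, v₁)` on `Fin 2`-indexed families attached to a bilinear map `g` with
`g(v, v) = 0` (plumbing for the universal property of `⋀²`). [cite: LangeBirkenhake1992, Lemma 1.1.17] -/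
def altTwo (g : V →ₗ[K] V →ₗ[K] N) (hg : ∀ v, g v v = 0) : V [⋀^Fin 2]→ₗ[K] N where
  toFun v := g (v 0) (v 1)
  map_update_add' := by
    intro _ v i a b
    fin_cases i
    · simp [Function.update_self, Function.update_of_ne]
    · simp [Function.update_self, Function.update_of_ne]
  map_update_smul' := by
    intro _ v i r a
    fin_cases i
    · simp [Function.update_self, Function.update_of_ne]
    · simp [Function.update_self, Function.update_of_ne]
  map_eq_zero_of_eq' := by
    intro v i j hv hij
    fin_cases i <;> fin_cases j
    · exact absurd rfl hij
    · have hv' : v 0 = v 1 := hv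
      change g (v 0) (v 1) = 0
      rw [hv', hg]
    · have hv' : v 1 = v 0 := hv
      change g (v 0) (v 1) = 0
      rw [hv', hg]
    · exact absurd rfl hij

/-- `altTwo g (v₀, v₁) = g v₀ v₁`. [cite: LangeBirkenhake1992, Lemma 1.1.17] -/
@[simp] theorem altTwo_apply (g : V →ₗ[K] V →ₗ[K] N) (hg : ∀ v, g v v = 0) (v : Fin 2 → V) :
    altTwo g hg v = g (v 0) (v 1) := rfl

end AltTwo

/-! ### §1 Linear maps out of `H²(A(ℂ); ℂ) = ⋀²H¹(A(ℂ); ℂ)` -/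

section Lift

variable {A : AbelianVariety ℂ} {N : Type} [AddCommGroup N] [Module ℂ N]

/-- `v₀ ⌣ (v₁ ⌣ 1) = v₀ ⌣ v₁`: the iterated product of two degree-one classes. [cite: HatcherAT2002, §3.2] -/
theorem cupPowOne_two (v : Fin 2 → complexBetti A.X 1) :
    cupPowOne ℂ (ComplexPoints A.X) 2 v = cupProduct (rfl : 1 + 1 = 2) (v 0) (v 1) := by
  rw [cupPowOne_succ, cupPowOne_one]
  rfl

/-- `![x, y] ↦ x ⌣ y`. [cite: HatcherAT2002, §3.2] -/
theorem cupPowOne_two' (x y : complexBetti A.X 1) :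
    cupPowOne ℂ (ComplexPoints A.X) 2 ![x, y] = cupProduct (rfl : 1 + 1 = 2) x y :=
  cupPowOne_two _

variable (A) in
/-- **The linear map `H²(A(ℂ); ℂ) → N` induced by an alternating map `H¹ × H¹ → N`** through the comparison
isomorphism `⋀²H¹(A(ℂ); ℂ) ≅ H²(A(ℂ); ℂ)` of a complex abelian variety (`H• = ⋀•H¹`, Lange–Birkenhake Lemma 1.1.17;
the tree's `HasExteriorCohomologyH1.equiv`) and the universal property of `⋀²`. [cite: LangeBirkenhake1992, Lemma 1.1.17] -/
def liftTwo (f : complexBetti A.X 1 [⋀^Fin 2]→ₗ[ℂ] N) : complexBetti A.X 2 →ₗ[ℂ] N :=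
  (exteriorPower.alternatingMapLinearEquiv f) ∘ₗ
    ((AbelianVariety.hasExteriorCohomologyH1_complexPoints A).equiv 2).symm.toLinearMap

/-- `liftTwo f (v₀ ⌣ v₁) = f(v₀, v₁)` on iterated products. [cite: LangeBirkenhake1992, Lemma 1.1.17] -/
theorem liftTwo_cupPowOne (f : complexBetti A.X 1 [⋀^Fin 2]→ₗ[ℂ] N) (v : Fin 2 → complexBetti A.X 1) :
    liftTwo A f (cupPowOne ℂ (ComplexPoints A.X) 2 v) = f v := by
  rw [liftTwo, LinearMap.comp_apply, LinearEquiv.coe_toLinearMap,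
    HasExteriorCohomologyH1.equiv_symm_cupPowOne, exteriorPower.alternatingMapLinearEquiv_apply_ιMulti]

/-- `liftTwo f (x ⌣ y) = f(x, y)`. [cite: LangeBirkenhake1992, Lemma 1.1.17] -/
theorem liftTwo_cupProduct (f : complexBetti A.X 1 [⋀^Fin 2]→ₗ[ℂ] N) (x y : complexBetti A.X 1) :
    liftTwo A f (cupProduct (rfl : 1 + 1 = 2) x y) = f ![x, y] := by
  rw [← cupPowOne_two', liftTwo_cupPowOne]

/-- Two linear maps out of `H²(A(ℂ); ℂ)` which agree on the products `x ⌣ y` are equal. [cite: LangeBirkenhake1992, Lemma 1.1.17] -/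
theorem linearMap_two_ext {f g : complexBetti A.X 2 →ₗ[ℂ] N}
    (h : ∀ x y : complexBetti A.X 1, f (cupProduct (rfl : 1 + 1 = 2) x y) = g (cupProduct (rfl : 1 + 1 = 2) x y)) :
    f = g := by
  refine exteriorPullback_ext (AbelianVariety.hasExteriorCohomologyH1_complexPoints A) fun v => ?_
  rw [cupPowOne_two]
  exact h _ _

end Lift

/-! ### §2 The interior product `ι_μ`, the derivation `D_X` and the contraction operator `T_c` -/

section Operators

variable {A : AbelianVariety ℂ} {ι : Type*} [Fintype ι]

variable (A) in
/-- **The interior product `ι_μ : H²(A(ℂ); ℂ) → H¹(A(ℂ); ℂ)` against a functional `μ` on `H¹`**,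
`ι_μ(x ⌣ y) = μ(y) x − μ(x) y` — the tree's contraction vectors `w_c(μ) = Σ_l a_l (μ(y_l) x_l − μ(x_l) y_l)` of a
`2`-vector `c = Σ_l a_l x_l ⌣ y_l` (`Milne1999/LefschetzGroupCentraliserInclusion`), as a canonical linear map of `c`
(well defined because `H² = ⋀²H¹`). [cite: LangeBirkenhake1992, Lemma 1.1.17] [cite: HatcherAT2002, §3.2 Thm. 3.11] -/
def interiorTwo (μ : Module.Dual ℂ (complexBetti A.X 1)) : complexBetti A.X 2 →ₗ[ℂ] complexBetti A.X 1 :=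
  liftTwo A (altTwo (LinearMap.mk₂ ℂ (fun x y : complexBetti A.X 1 => μ y • x - μ x • y)
    (fun x x' y => by simp only [map_add]; module) (fun r x y => by simp only [map_smul, smul_eq_mul]; module)
    (fun x y y' => by simp only [map_add]; module) (fun r x y => by simp only [map_smul, smul_eq_mul]; module))
    (fun v => by simp))

/-- `ι_μ(x ⌣ y) = μ(y) x − μ(x) y`. [cite: HatcherAT2002, §3.2 Thm. 3.11] -/
@[simp] theorem interiorTwo_cupProduct (μ : Module.Dual ℂ (complexBetti A.X 1)) (x y : complexBetti A.X 1) :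
    interiorTwo A μ (cupProduct (rfl : 1 + 1 = 2) x y) = μ y • x - μ x • y := by
  rw [interiorTwo, liftTwo_cupProduct, altTwo_apply]
  rfl

/-- `ι_μ` of a `2`-vector `Σ_l a_l x_l ⌣ y_l` is the contraction vector `Σ_l a_l (μ(y_l) x_l − μ(x_l) y_l)`.
[cite: HatcherAT2002, §3.2 Thm. 3.11] -/
theorem interiorTwo_sum_smul_cupProduct (μ : Module.Dual ℂ (complexBetti A.X 1)) (a : ι → ℂ)
    (x y : ι → complexBetti A.X 1) :
    interiorTwo A μ (∑ l, a l • cupProduct (rfl : 1 + 1 = 2) (x l) (y l)) =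
      ∑ l, a l • (μ (y l) • x l - μ (x l) • y l) := by
  simp only [map_sum, map_smul, interiorTwo_cupProduct]

/-- `ι_μ` is additive in `μ`. [cite: HatcherAT2002, §3.2 Thm. 3.11] -/
theorem interiorTwo_add (μ μ' : Module.Dual ℂ (complexBetti A.X 1)) :
    interiorTwo A (μ + μ') = interiorTwo A μ + interiorTwo A μ' := by
  refine linearMap_two_ext fun x y => ?_
  simp only [interiorTwo_cupProduct, LinearMap.add_apply]
  module

/-- `ι_μ` is homogeneous in `μ`. [cite: HatcherAT2002, §3.2 Thm. 3.11] -/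
theorem interiorTwo_smul (r : ℂ) (μ : Module.Dual ℂ (complexBetti A.X 1)) :
    interiorTwo A (r • μ) = r • interiorTwo A μ := by
  refine linearMap_two_ext fun x y => ?_
  simp only [interiorTwo_cupProduct, LinearMap.smul_apply, smul_eq_mul]
  module

/-- **Equivariance of the interior product under the exterior action**: for an endomorphism `u` of `H¹`,
`ι_μ(⋀²u c) = u(ι_{μ ∘ u} c)`. [cite: HatcherAT2002, §3.2 Prop. 3.10] -/
theorem interiorTwo_exteriorPullback (μ : Module.Dual ℂ (complexBetti A.X 1))
    (u : complexBetti A.X 1 →ₗ[ℂ] complexBetti A.X 1) (c : complexBetti A.X 2) :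
    interiorTwo A μ (exteriorPullback (AbelianVariety.hasExteriorCohomologyH1_complexPoints A) u 2 c) =
      u (interiorTwo A (μ ∘ₗ u) c) := by
  have key : interiorTwo A μ ∘ₗ exteriorPullback (AbelianVariety.hasExteriorCohomologyH1_complexPoints A) u 2 =
      u ∘ₗ interiorTwo A (μ ∘ₗ u) := by
    refine linearMap_two_ext fun x y => ?_
    rw [LinearMap.comp_apply, LinearMap.comp_apply, exteriorPullback_cupProduct_one_one, interiorTwo_cupProduct,
      interiorTwo_cupProduct]
    simp only [LinearMap.comp_apply, map_sub, map_smul]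
  exact LinearMap.congr_fun key c

variable (A) in
/-- **The derivation `D_X : H²(A(ℂ); ℂ) → H²(A(ℂ); ℂ)` of an endomorphism `X` of `H¹`**,
`D_X(x ⌣ y) = Xx ⌣ y + x ⌣ Xy` (the infinitesimal form of the exterior action `⋀²`; `Xv ⌣ v + v ⌣ Xv = 0` by graded
commutativity). [cite: HatcherAT2002, §3.2 Thm. 3.11] [cite: LangeBirkenhake1992, Lemma 1.1.17] -/
def derivTwo (X : Module.End ℂ (complexBetti A.X 1)) : complexBetti A.X 2 →ₗ[ℂ] complexBetti A.X 2 :=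
  liftTwo A (altTwo
    ((cupProduct (rfl : 1 + 1 = 2)).compl₁₂ X LinearMap.id + (cupProduct (rfl : 1 + 1 = 2)).compl₁₂ LinearMap.id X)
    (fun v => by
      simp only [LinearMap.add_apply, LinearMap.compl₁₂_apply, LinearMap.id_apply]
      rw [cupProduct_gradedComm_holds ℂ (ComplexPoints A.X) (rfl : 1 + 1 = 2) rfl v (X v)]
      simp))

/-- `D_X(x ⌣ y) = Xx ⌣ y + x ⌣ Xy`. [cite: HatcherAT2002, §3.2 Thm. 3.11] -/
@[simp] theorem derivTwo_cupProduct (X : Module.End ℂ (complexBetti A.X 1)) (x y : complexBetti A.X 1) :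
    derivTwo A X (cupProduct (rfl : 1 + 1 = 2) x y) =
      cupProduct (rfl : 1 + 1 = 2) (X x) y + cupProduct (rfl : 1 + 1 = 2) x (X y) := by
  rw [derivTwo, liftTwo_cupProduct, altTwo_apply]
  rfl

/-- `D_X` of a `2`-vector. [cite: HatcherAT2002, §3.2 Thm. 3.11] -/
theorem derivTwo_sum_smul_cupProduct (X : Module.End ℂ (complexBetti A.X 1)) (a : ι → ℂ)
    (x y : ι → complexBetti A.X 1) :
    derivTwo A X (∑ l, a l • cupProduct (rfl : 1 + 1 = 2) (x l) (y l)) =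
      ∑ l, a l • (cupProduct (rfl : 1 + 1 = 2) (X (x l)) (y l) + cupProduct (rfl : 1 + 1 = 2) (x l) (X (y l))) := by
  simp only [map_sum, map_smul, derivTwo_cupProduct]

/-- `D_X` is additive in `X`. [cite: HatcherAT2002, §3.2 Thm. 3.11] -/
theorem derivTwo_add (X Y : Module.End ℂ (complexBetti A.X 1)) : derivTwo A (X + Y) = derivTwo A X + derivTwo A Y := by
  refine linearMap_two_ext fun x y => ?_
  simp only [derivTwo_cupProduct, LinearMap.add_apply, map_add]
  abel

/-- `D_X` is homogeneous in `X`. [cite: HatcherAT2002, §3.2 Thm. 3.11] -/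
theorem derivTwo_smul (r : ℂ) (X : Module.End ℂ (complexBetti A.X 1)) : derivTwo A (r • X) = r • derivTwo A X := by
  refine linearMap_two_ext fun x y => ?_
  simp only [derivTwo_cupProduct, LinearMap.smul_apply, map_smul, smul_add]

/-- **`ι_μ ∘ D_X = X ∘ ι_μ + ι_{μ ∘ X}`**: the interior product of a derived `2`-vector.
[cite: HatcherAT2002, §3.2 Thm. 3.11] -/
theorem interiorTwo_derivTwo (μ : Module.Dual ℂ (complexBetti A.X 1)) (X : Module.End ℂ (complexBetti A.X 1))
    (c : complexBetti A.X 2) :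
    interiorTwo A μ (derivTwo A X c) = X (interiorTwo A μ c) + interiorTwo A (μ ∘ₗ X) c := by
  have key : interiorTwo A μ ∘ₗ derivTwo A X = X ∘ₗ interiorTwo A μ + interiorTwo A (μ ∘ₗ X) := by
    refine linearMap_two_ext fun x y => ?_
    simp only [LinearMap.comp_apply, LinearMap.add_apply, derivTwo_cupProduct, map_add, interiorTwo_cupProduct,
      map_sub, map_smul]
    abel
  exact LinearMap.congr_fun key c

variable (A) in
/-- **The contraction operator `T_c = W_c ∘ B♭` of a class `c ∈ H²(A(ℂ); ℂ)`** with respect to a scalar bilinear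
form `B` on `H¹(A(ℂ); ℂ)`: `T_c(v) = ι_{B(v, ·)}(c)`, i.e. `T_c(v) = Σ_l a_l (B(v, y_l) x_l − B(v, x_l) y_l)` for
`c = Σ_l a_l x_l ⌣ y_l` (Milne §1: the dictionary between `2`-vectors / the forms `e_D` and endomorphisms of
`V(A)` through the non-degenerate `e_D` of an ample divisor; the tree's `T_c = W_c ∘ Q♭` of
`Milne1999/CentraliserFixesDivisorClasses`), linear in `c`. [cite: Milne1999LefschetzClasses, §1 p. 642 and Prop. 1.3]
[cite: LangeBirkenhake1992, Prop. 5.2.1] -/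
def contractionOp (B : LinearMap.BilinForm ℂ (complexBetti A.X 1)) :
    complexBetti A.X 2 →ₗ[ℂ] Module.End ℂ (complexBetti A.X 1) where
  toFun c :=
    { toFun := fun v => interiorTwo A (B v) c
      map_add' := fun v w => by rw [map_add, interiorTwo_add, LinearMap.add_apply]
      map_smul' := fun r v => by rw [map_smul, interiorTwo_smul, LinearMap.smul_apply, RingHom.id_apply] }
  map_add' c c' := by ext v; simp only [map_add, LinearMap.coe_mk, AddHom.coe_mk, LinearMap.add_apply]
  map_smul' r c := by ext v; simp only [map_smul, LinearMap.coe_mk, AddHom.coe_mk, LinearMap.smul_apply, RingHom.id_apply]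

/-- `T_c(v) = ι_{B(v,·)}(c)`. [cite: Milne1999LefschetzClasses, §1 p. 642] -/
theorem contractionOp_apply (B : LinearMap.BilinForm ℂ (complexBetti A.X 1)) (c : complexBetti A.X 2)
    (v : complexBetti A.X 1) : contractionOp A B c v = interiorTwo A (B v) c := rfl

/-- `T_c(v) = Σ_l a_l (B(v, y_l) x_l − B(v, x_l) y_l)` for `c = Σ_l a_l x_l ⌣ y_l`. [cite: Milne1999LefschetzClasses, §1 p. 642] -/
theorem contractionOp_sum_smul_cupProduct_apply (B : LinearMap.BilinForm ℂ (complexBetti A.X 1)) (a : ι → ℂ)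
    (x y : ι → complexBetti A.X 1) (v : complexBetti A.X 1) :
    contractionOp A B (∑ l, a l • cupProduct (rfl : 1 + 1 = 2) (x l) (y l)) v =
      ∑ l, a l • (B v (y l) • x l - B v (x l) • y l) := by
  rw [contractionOp_apply, interiorTwo_sum_smul_cupProduct]

/-- `T_{x ⌣ y}(v) = B(v, y) x − B(v, x) y`. [cite: Milne1999LefschetzClasses, §1 p. 642] -/
theorem contractionOp_cupProduct_apply (B : LinearMap.BilinForm ℂ (complexBetti A.X 1)) (x y v : complexBetti A.X 1) :
    contractionOp A B (cupProduct (rfl : 1 + 1 = 2) x y) v = B v y • x - B v x • y := by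
  rw [contractionOp_apply, interiorTwo_cupProduct]

end Operators

/-! ### §3 The basis identity `2c = Σᵢ ι_{βᵢ}(c) ⌣ bᵢ`, injectivity and symmetry of `c ↦ T_c` -/

section Basic

variable {A : AbelianVariety ℂ} {ι : Type*} [Fintype ι] {κ : Type*} [Fintype κ]

/-- **`2c = Σᵢ ι_{βᵢ}(c) ⌣ bᵢ`** for a basis `b` of `H¹(A(ℂ); ℂ)` with coordinates `βᵢ` (both sides are linear in `c`;
on `x ⌣ y`: bilinearity, `Σᵢ βᵢ(v) bᵢ = v` and `y ⌣ x = −x ⌣ y`). [cite: HatcherAT2002, §3.2 Thm. 3.11] -/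
theorem two_smul_eq_sum_cup_interiorTwo (b : Module.Basis κ ℂ (complexBetti A.X 1)) (c : complexBetti A.X 2) :
    (2 : ℂ) • c = ∑ i, cupProduct (rfl : 1 + 1 = 2) (interiorTwo A (b.coord i) c) (b i) := by
  set Φ : complexBetti A.X 2 →ₗ[ℂ] complexBetti A.X 2 :=
    ∑ i, (cupProduct (rfl : 1 + 1 = 2)).flip (b i) ∘ₗ interiorTwo A (b.coord i) with hΦ
  have hΦapp : ∀ c, Φ c = ∑ i, cupProduct (rfl : 1 + 1 = 2) (interiorTwo A (b.coord i) c) (b i) := by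
    intro c
    simp only [hΦ, LinearMap.sum_apply, LinearMap.comp_apply, LinearMap.flip_apply]
  rw [← hΦapp]
  suffices h : (2 : ℂ) • (LinearMap.id : complexBetti A.X 2 →ₗ[ℂ] complexBetti A.X 2) = Φ by
    have e := LinearMap.congr_fun h c
    rw [LinearMap.smul_apply, LinearMap.id_apply] at e
    exact e
  refine linearMap_two_ext fun x y => ?_
  rw [LinearMap.smul_apply, LinearMap.id_apply, hΦapp]
  simp only [interiorTwo_cupProduct, map_sub, map_smul, LinearMap.sub_apply, LinearMap.smul_apply]
  have expand : ∀ v w : complexBetti A.X 1,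
      ∑ i, b.coord i w • cupProduct (rfl : 1 + 1 = 2) v (b i) = cupProduct (rfl : 1 + 1 = 2) v w := by
    intro v w
    calc ∑ i, b.coord i w • cupProduct (rfl : 1 + 1 = 2) v (b i)
        = cupProduct (rfl : 1 + 1 = 2) v (∑ i, b.coord i w • b i) := by rw [map_sum]; simp only [map_smul]
      _ = cupProduct (rfl : 1 + 1 = 2) v w := by simp_rw [Module.Basis.coord_apply, Module.Basis.sum_repr]
  rw [Finset.sum_sub_distrib, expand, expand,
    cupProduct_gradedComm_holds ℂ (ComplexPoints A.X) (rfl : 1 + 1 = 2) rfl y x]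
  simp only [mul_one, pow_one, neg_smul, one_smul, sub_neg_eq_add, two_smul]

/-- **A `2`-vector all of whose interior products vanish is zero.** [cite: HatcherAT2002, §3.2 Thm. 3.11] -/
theorem eq_zero_of_forall_interiorTwo_eq_zero {c : complexBetti A.X 2}
    (h : ∀ μ : Module.Dual ℂ (complexBetti A.X 1), interiorTwo A μ c = 0) : c = 0 := by
  haveI : Module.Finite ℂ (complexBetti A.X 1) := abelianVarietyCohomologyExteriorH1_holds.finite_one A
  let b := Module.finBasis ℂ (complexBetti A.X 1)
  have e := two_smul_eq_sum_cup_interiorTwo b c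
  simp only [h, map_zero, LinearMap.zero_apply, Finset.sum_const_zero] at e
  exact (smul_eq_zero.1 e).resolve_left two_ne_zero

/-- **`c ↦ T_c` is injective** for a non-degenerate `B` (`B♭ : H¹ → (H¹)^∨` is onto, so every `ι_μ(c)` is a
`T_c(v)`). [cite: Milne1999LefschetzClasses, §1 p. 642 (e_D nondegenerate)] -/
theorem eq_zero_of_contractionOp_eq_zero {B : LinearMap.BilinForm ℂ (complexBetti A.X 1)} (hBnd : B.Nondegenerate)
    {c : complexBetti A.X 2} (hc : contractionOp A B c = 0) : c = 0 := by
  haveI : Module.Finite ℂ (complexBetti A.X 1) := abelianVarietyCohomologyExteriorH1_holds.finite_one A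
  refine eq_zero_of_forall_interiorTwo_eq_zero fun μ => ?_
  obtain ⟨v, hv⟩ := (B.toDual hBnd).surjective μ
  have hv2 : B v = μ := LinearMap.ext fun n => by rw [← hv, LinearMap.BilinForm.toDual_def]
  have e := LinearMap.congr_fun hc v
  rw [contractionOp_apply, LinearMap.zero_apply, hv2] at e
  exact e

/-- `c ↦ T_c` is injective (non-degenerate `B`). [cite: Milne1999LefschetzClasses, §1 p. 642] -/
theorem contractionOp_injective {B : LinearMap.BilinForm ℂ (complexBetti A.X 1)} (hBnd : B.Nondegenerate) :
    Function.Injective (contractionOp A B) := by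
  rw [← LinearMap.ker_eq_bot, LinearMap.ker_eq_bot']
  exact fun c hc => eq_zero_of_contractionOp_eq_zero hBnd hc

/-- **`T_c` is `B`-symmetric for an alternating `B`**: `B(T_c v, w) = B(v, T_c w)` (the forms
`ψ(x, y) = e(T x, y)` attached to `2`-vectors are skew, Prop. 1.3). [cite: Milne1999LefschetzClasses, §1 Prop. 1.3] -/
theorem bilin_contractionOp_apply {B : LinearMap.BilinForm ℂ (complexBetti A.X 1)} (hBalt : B.IsAlt)
    (c : complexBetti A.X 2) (v w : complexBetti A.X 1) :
    B (contractionOp A B c v) w = B v (contractionOp A B c w) := by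
  -- both sides are linear in `c`; check on `x ⌣ y`
  set L₁ : complexBetti A.X 2 →ₗ[ℂ] ℂ := (B.flip w) ∘ₗ (LinearMap.applyₗ v ∘ₗ contractionOp A B) with hL₁
  set L₂ : complexBetti A.X 2 →ₗ[ℂ] ℂ := (B v) ∘ₗ (LinearMap.applyₗ w ∘ₗ contractionOp A B) with hL₂
  have e₁ : ∀ c, L₁ c = B (contractionOp A B c v) w := fun c => rfl
  have e₂ : ∀ c, L₂ c = B v (contractionOp A B c w) := fun c => rfl
  rw [← e₁, ← e₂]
  suffices h : L₁ = L₂ from LinearMap.congr_fun h c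
  refine linearMap_two_ext fun x y => ?_
  rw [e₁, e₂, contractionOp_cupProduct_apply, contractionOp_cupProduct_apply]
  simp only [map_sub, map_smul, LinearMap.sub_apply, LinearMap.smul_apply, smul_eq_mul]
  rw [← hBalt.neg_eq w x, ← hBalt.neg_eq w y]
  ring

/-- **Equivariance**: for an isometry `u` of `B`, `T_{⋀²u c} = u ∘ T_c ∘ u⁻¹`, i.e. `T_{⋀²u c}(u v) = u(T_c v)`.
[cite: Milne1999LefschetzClasses, Thm. 4.4 (proof: `e_D(γx, γy) = γ†γ e_D(x, y)`)] -/
theorem contractionOp_exteriorPullback_apply {B : LinearMap.BilinForm ℂ (complexBetti A.X 1)}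
    (u : complexBetti A.X 1 ≃ₗ[ℂ] complexBetti A.X 1) (hu : ∀ v w, B (u v) (u w) = B v w) (c : complexBetti A.X 2)
    (v : complexBetti A.X 1) :
    contractionOp A B (exteriorPullback (AbelianVariety.hasExteriorCohomologyH1_complexPoints A)
      (u : complexBetti A.X 1 →ₗ[ℂ] complexBetti A.X 1) 2 c) (u v) = u (contractionOp A B c v) := by
  rw [contractionOp_apply, contractionOp_apply, interiorTwo_exteriorPullback]
  have hμ : B (u v) ∘ₗ (u : complexBetti A.X 1 →ₗ[ℂ] complexBetti A.X 1) = B v :=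
    LinearMap.ext fun w => by rw [LinearMap.comp_apply, LinearEquiv.coe_coe, hu]
  rw [hμ]
  rfl

end Basic

/-! ### §4 The derivation rule `T_{D_X c} = X T_c + T_c X†` and `D_{φ^*}` on divisor classes -/

section Derivation

variable {A : AbelianVariety ℂ}

/-- **`T_{D_X c} = X ∘ T_c + T_c ∘ X†`** for an endomorphism `X` of `H¹` with (right) `B`-adjoint `X†`,
`B(v, Xw) = B(X†v, w)`. [cite: Milne1999LefschetzClasses, §1 p. 642 (`β ↦ β†`)] [cite: LangeBirkenhake1992, Prop. 5.2.1] -/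
theorem contractionOp_derivTwo {B : LinearMap.BilinForm ℂ (complexBetti A.X 1)} {X X' : Module.End ℂ (complexBetti A.X 1)}
    (hX' : ∀ v w, B v (X w) = B (X' v) w) (c : complexBetti A.X 2) :
    contractionOp A B (derivTwo A X c) = X * contractionOp A B c + contractionOp A B c * X' := by
  refine LinearMap.ext fun v => ?_
  rw [contractionOp_apply, interiorTwo_derivTwo, LinearMap.add_apply, Module.End.mul_apply, Module.End.mul_apply,
    contractionOp_apply, contractionOp_apply]
  have hμ : B v ∘ₗ X = B (X' v) := LinearMap.ext fun w => hX' v w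
  rw [hμ]

/-- `𝟙^* = id` on `H¹(A(ℂ); ℂ)`. [cite: LangeBirkenhake1992, §1.1 (p. 19)] -/
theorem pullbackOne_id_apply (z : complexBetti A.X 1) : pullbackOne A (𝟙 A) z = z := by
  change complexBetti.map (𝟙 A.X) 1 z = z
  rw [complexBetti.map_id]
  rfl

/-- `𝟙^* = id` on `H²(A(ℂ); ℂ)`. [cite: HatcherAT2002, §3.2 Prop. 3.10] -/
theorem complexBetti_map_id_two_apply (c : complexBetti A.X 2) : complexBetti.map (𝟙 A : A ⟶ A).hom.hom.hom 2 c = c := by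
  change complexBetti.map (𝟙 A.X) 2 c = c
  rw [complexBetti.map_id]
  rfl

/-- `(φ + ψ)^* = φ^* + ψ^*` on `H¹(A(ℂ); ℂ)`, elementwise (the tree's `complexBetti_map_add_one`).
[cite: LangeBirkenhake1992, §1.1 (p. 19)] -/
theorem pullbackOne_add_apply (φ ψ : A ⟶ A) (z : complexBetti A.X 1) :
    pullbackOne A (φ + ψ) z = pullbackOne A φ z + pullbackOne A ψ z := by
  change complexBetti.map (φ + ψ).hom.hom.hom 1 z = _
  rw [complexBetti_map_add_one]
  change ((complexBetti.map φ.hom.hom.hom 1 + complexBetti.map ψ.hom.hom.hom 1).hom) z = _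
  rw [ModuleCat.hom_add, LinearMap.add_apply]

/-- `ψ^*(x ⌣ y) = ψ^*x ⌣ ψ^*y` (Hatcher Prop. 3.10, the tree's `cupProduct_map`), in the `pullbackOne` spelling.
[cite: HatcherAT2002, §3.2 Prop. 3.10] -/
theorem complexBetti_map_two_cupProduct (ψ : A ⟶ A) (x y : complexBetti A.X 1) :
    (complexBetti.map ψ.hom.hom.hom 2).hom (cupProduct (rfl : 1 + 1 = 2) x y) =
      cupProduct (rfl : 1 + 1 = 2) (pullbackOne A ψ x) (pullbackOne A ψ y) :=
  cupProduct_map _ (rfl : 1 + 1 = 2) x y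

/-- **`D_{φ^*} c = (𝟙 + φ)^* c − c − φ^* c`** on `H²(A(ℂ); ℂ)`: pull-backs are multiplicative (Hatcher Prop. 3.10)
and `(𝟙 + φ)^* = id + φ^*` on `H¹` (Lange–Birkenhake §1.1, the tree's `complexBetti_map_add_one`), so
`(x + φ^*x) ⌣ (y + φ^*y) − x ⌣ y − φ^*x ⌣ φ^*y = φ^*x ⌣ y + x ⌣ φ^*y`. [cite: HatcherAT2002, §3.2 Prop. 3.10]
[cite: LangeBirkenhake1992, §1.1 (p. 19)] -/
theorem derivTwo_pullbackOne (φ : A ⟶ A) (c : complexBetti A.X 2) :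
    derivTwo A (pullbackOne A φ) c =
      complexBetti.map (𝟙 A + φ).hom.hom.hom 2 c - c - complexBetti.map φ.hom.hom.hom 2 c := by
  have key : derivTwo A (pullbackOne A φ) =
      (complexBetti.map (𝟙 A + φ).hom.hom.hom 2).hom - LinearMap.id - (complexBetti.map φ.hom.hom.hom 2).hom := by
    refine linearMap_two_ext fun x y => ?_
    rw [derivTwo_cupProduct, LinearMap.sub_apply, LinearMap.sub_apply, LinearMap.id_apply,
      complexBetti_map_two_cupProduct, complexBetti_map_two_cupProduct, pullbackOne_add_apply, pullbackOne_add_apply,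
      pullbackOne_id_apply, pullbackOne_id_apply]
    simp only [map_add, LinearMap.add_apply]
    abel
  rw [key]
  rfl

/-- **`D_{φ^*}` preserves `B¹(A) ⊗ ℂ`** (the `ℂ`-span of the rational `(1,1)`-classes): pull-backs of rational
`(1,1)`-classes along homomorphisms are rational `(1,1)`-classes (the tree's `map_mem_hodgeClassSpan_one`).
[cite: Milne1999LefschetzClasses, §1 p. 642] [cite: VoisinHodgeI2002, §7.3.2 and §11.3] -/
theorem derivTwo_pullbackOne_mem_hodgeClassSpan (φ : A ⟶ A) {c : complexBetti A.X 2}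
    (hc : c ∈ hodgeClassSpan A.dim A.X 1) : derivTwo A (pullbackOne A φ) c ∈ hodgeClassSpan A.dim A.X 1 := by
  rw [derivTwo_pullbackOne]
  exact sub_mem (sub_mem (map_mem_hodgeClassSpan_one _ hc) hc) (map_mem_hodgeClassSpan_one _ hc)

/-- `D_X` preserves `B¹(A) ⊗ ℂ` for every `X` in the `ℂ`-span of the pull-backs `φ^*` (`End⁰(A) ⊗ ℂ` acting).
[cite: Milne1999LefschetzClasses, §1 p. 642] -/
theorem derivTwo_mem_hodgeClassSpan_of_mem_span {X : Module.End ℂ (complexBetti A.X 1)}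
    (hX : X ∈ Submodule.span ℂ (Set.range fun φ : A ⟶ A ↦ pullbackOne A φ)) {c : complexBetti A.X 2}
    (hc : c ∈ hodgeClassSpan A.dim A.X 1) : derivTwo A X c ∈ hodgeClassSpan A.dim A.X 1 := by
  induction hX using Submodule.span_induction with
  | mem X hX =>
    obtain ⟨φ, rfl⟩ := hX
    exact derivTwo_pullbackOne_mem_hodgeClassSpan φ hc
  | zero =>
    have h0 : derivTwo A (0 : Module.End ℂ (complexBetti A.X 1)) = 0 := by
      have e := derivTwo_smul (A := A) (0 : ℂ) 0
      rwa [zero_smul, zero_smul] at e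
    rw [h0, LinearMap.zero_apply]
    exact zero_mem _
  | add X Y _ _ hX hY => rw [derivTwo_add, LinearMap.add_apply]; exact add_mem hX hY
  | smul r X _ hX => rw [derivTwo_smul, LinearMap.smul_apply]; exact Submodule.smul_mem _ r hX

end Derivation

/-! ### §5 `T_c ∈ E''` for `c ∈ B¹(A) ⊗ ℂ` (Deligne's commutant theorem with Riemann's theorem) -/

section ToSpan

variable {A : AbelianVariety ℂ} {ι : Type*} [Fintype ι]

/-- The bicommutant `E''` of the `φ^*` — the centraliser of Milne's `C(A) ⊗ ℂ = centralizerAlgebra A` in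
`End_ℂ H¹(A(ℂ); ℂ)` — IS the `ℂ`-span of the `φ^*` (`End⁰(A) ⊗ ℂ` acting; Remark 1.2), unconditionally: the tree's
`centralizer_centralizerAlgebra_eq_span_of_riemann` fed with the PROVED Riemann theorem
`deligneMilne1982_Thm_6_20_full_holds`. [cite: Milne1999LefschetzClasses, §1 Remark 1.2 (p. 643)]
[cite: DeligneMilne1982Tannakian, II Thm. 6.20] -/
theorem mem_bicommutant_iff_mem_span {X : Module.End ℂ (complexBetti A.X 1)} :
    X ∈ Subalgebra.centralizer ℂ (centralizerAlgebra A : Set (Module.End ℂ (complexBetti A.X 1))) ↔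
      X ∈ Submodule.span ℂ (Set.range fun φ : A ⟶ A ↦ pullbackOne A φ) := by
  rw [← centralizer_centralizerAlgebra_eq_span_of_riemann A deligneMilne1982_Thm_6_20_full_holds,
    Subalgebra.mem_toSubmodule]

/-- Every `φ^*` lies in the bicommutant `E''`. [cite: Milne1999LefschetzClasses, §1 Remark 1.2 (p. 643)] -/
theorem pullbackOne_mem_bicommutant (φ : A ⟶ A) :
    pullbackOne A φ ∈ Subalgebra.centralizer ℂ (centralizerAlgebra A : Set (Module.End ℂ (complexBetti A.X 1))) :=
  pullbackOne_mem_centralizer_centralizerAlgebra φ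

/-- A representation of any class `c ∈ H²(A(ℂ); ℂ)` as a `2`-vector: `c = Σᵢ ½ ι_{βᵢ}(c) ⌣ bᵢ`.
[cite: HatcherAT2002, §3.2 Thm. 3.11] -/
theorem eq_sum_half_smul_cup_interiorTwo {κ : Type*} [Fintype κ] (b : Module.Basis κ ℂ (complexBetti A.X 1))
    (c : complexBetti A.X 2) :
    c = ∑ i, (2 : ℂ)⁻¹ • cupProduct (rfl : 1 + 1 = 2) (interiorTwo A (b.coord i) c) (b i) := by
  rw [← Finset.smul_sum, ← two_smul_eq_sum_cup_interiorTwo b c, smul_smul, inv_mul_cancel₀ two_ne_zero, one_smul]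

/-- **The Hodge group moves `ι_μ(c)` equivariantly for `c ∈ B¹(A) ⊗ ℂ`**: `g₁ ι_{μ ∘ g₁}(c) = ι_μ(c)` for
`g ∈ Hg(A)(ℂ)` and `dim A ≥ 1` (the tree's `apply_one_contraction_eq_of_mem_hodgeGroup` for rational
`(1,1)`-classes, extended by linearity). [cite: Milne1999LefschetzClasses, §4 p. 660 (`L(A) ⊃ Hg(A)`)] -/
theorem apply_one_interiorTwo_comp_eq_of_mem_hodgeClassSpan (hn : 1 ≤ A.dim) {c : complexBetti A.X 2}
    (hc : c ∈ hodgeClassSpan A.dim A.X 1) {g : ∀ k : ℕ, complexBetti A.X k ≃ₗ[ℂ] complexBetti A.X k}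
    (hg : g ∈ hodgeGroup A.dim A.X) (μ : Module.Dual ℂ (complexBetti A.X 1)) :
    g 1 (interiorTwo A (μ ∘ₗ (g 1 : complexBetti A.X 1 →ₗ[ℂ] complexBetti A.X 1)) c) = interiorTwo A μ c := by
  haveI : Module.Finite ℂ (complexBetti A.X 1) := abelianVarietyCohomologyExteriorH1_holds.finite_one A
  induction hc using Submodule.span_induction with
  | mem c hc =>
    obtain ⟨hcQ, hc11⟩ := hc
    let b := Module.finBasis ℂ (complexBetti A.X 1)
    have hrep := eq_sum_half_smul_cup_interiorTwo b c
    have key := apply_one_contraction_eq_of_mem_hodgeGroup hn hcQ hc11 (fun _ => (2 : ℂ)⁻¹)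
      (fun i => interiorTwo A (b.coord i) c) (fun i => b i) hrep hg μ
    rw [hrep, interiorTwo_sum_smul_cupProduct, interiorTwo_sum_smul_cupProduct]
    simpa only [LinearMap.comp_apply, LinearEquiv.coe_coe] using key
  | zero => simp
  | add c c' _ _ hc hc' => rw [map_add, map_add, map_add, hc, hc']
  | smul r c _ hc => rw [map_smul, map_smul, map_smul, hc]

/-- **`T_c` commutes with the Hodge group** for `c ∈ B¹(A) ⊗ ℂ` and a scalar form `B` preserved by `Hg(A)(ℂ)|_{H¹}`.
[cite: Milne1999LefschetzClasses, §4 p. 660] [cite: Deligne1982HodgeCycles, I §3 Prop. 3.4] -/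
theorem contractionOp_apply_one_eq (hn : 1 ≤ A.dim) {B : LinearMap.BilinForm ℂ (complexBetti A.X 1)}
    (hBHg : ∀ g ∈ hodgeGroup A.dim A.X, ∀ v w : complexBetti A.X 1, B (g 1 v) (g 1 w) = B v w)
    {c : complexBetti A.X 2} (hc : c ∈ hodgeClassSpan A.dim A.X 1)
    {g : ∀ k : ℕ, complexBetti A.X k ≃ₗ[ℂ] complexBetti A.X k} (hg : g ∈ hodgeGroup A.dim A.X)
    (v : complexBetti A.X 1) : contractionOp A B c (g 1 v) = g 1 (contractionOp A B c v) := by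
  rw [contractionOp_apply, contractionOp_apply,
    ← apply_one_interiorTwo_comp_eq_of_mem_hodgeClassSpan hn hc hg (B (g 1 v))]
  have hμ : B (g 1 v) ∘ₗ (g 1 : complexBetti A.X 1 →ₗ[ℂ] complexBetti A.X 1) = B v :=
    LinearMap.ext fun w => by rw [LinearMap.comp_apply, LinearEquiv.coe_coe, hBHg g hg]
  rw [hμ]

/-- **`T_c ∈ E''` for `c ∈ B¹(A) ⊗ ℂ`** (`dim A ≥ 1`, `B` preserved by the Hodge group): `T_c` commutes with
`Hg(A)(ℂ)|_{H¹}`, hence lies in the `ℂ`-span of the `φ^*` (Deligne I Prop. 3.4 with Riemann's theorem, the tree's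
`Deligne1982.mem_span_complexBetti_map_of_commute_hodgeGroup_of_riemann` and `deligneMilne1982_Thm_6_20_full_holds`),
which is the bicommutant. (Milne: `NS ⊗ k ↪ {α ∈ End⁰(A) ⊗ k | α† = α}`.)
[cite: Milne1999LefschetzClasses, §1 Prop. 1.3 and Remark 1.2] [cite: Deligne1982HodgeCycles, I §5 Prop. 5.1 (proof)]
[cite: DeligneMilne1982Tannakian, II Thm. 6.20] -/
theorem contractionOp_mem_bicommutant (hn : 1 ≤ A.dim) {B : LinearMap.BilinForm ℂ (complexBetti A.X 1)}
    (hBHg : ∀ g ∈ hodgeGroup A.dim A.X, ∀ v w : complexBetti A.X 1, B (g 1 v) (g 1 w) = B v w)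
    {c : complexBetti A.X 2} (hc : c ∈ hodgeClassSpan A.dim A.X 1) :
    contractionOp A B c ∈ Subalgebra.centralizer ℂ (centralizerAlgebra A : Set (Module.End ℂ (complexBetti A.X 1))) :=
  mem_bicommutant_iff_mem_span.2 (Deligne1982.mem_span_complexBetti_map_of_commute_hodgeGroup_of_riemann
    deligneMilne1982_Thm_6_20_full_holds A _ fun _ hg v => contractionOp_apply_one_eq hn hBHg hc hg v)

end ToSpan

/-! ### §6 Adjoints for a non-degenerate `B` and the `†`-stability of `E''` -/

section Adjoint

variable {A : AbelianVariety ℂ} {B : LinearMap.BilinForm ℂ (complexBetti A.X 1)}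

/-- Every endomorphism `X` of `H¹(A(ℂ); ℂ)` has a (right) `B`-adjoint `X†`, `B(v, Xw) = B(X†v, w)`, for `B`
non-degenerate (Mathlib `leftAdjointOfNondegenerate`). [cite: Milne1999LefschetzClasses, §1 p. 642 (`β ↦ β†`)] -/
theorem exists_rightAdjoint (hBnd : B.Nondegenerate) (X : Module.End ℂ (complexBetti A.X 1)) :
    ∃ X' : Module.End ℂ (complexBetti A.X 1), ∀ v w, B v (X w) = B (X' v) w := by
  haveI : Module.Finite ℂ (complexBetti A.X 1) := abelianVarietyCohomologyExteriorH1_holds.finite_one A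
  exact ⟨B.leftAdjointOfNondegenerate hBnd X, fun v w =>
    (LinearMap.BilinForm.isAdjointPairLeftAdjointOfNondegenerate B hBnd X v w).symm⟩

/-- The adjoint is unique (non-degeneracy): two right adjoints of `X` agree. [cite: Milne1999LefschetzClasses, §1 p. 642] -/
theorem rightAdjoint_unique (hBnd : B.Nondegenerate) {X X' X'' : Module.End ℂ (complexBetti A.X 1)}
    (h' : ∀ v w, B v (X w) = B (X' v) w) (h'' : ∀ v w, B v (X w) = B (X'' v) w) : X' = X'' := by
  refine LinearMap.ext fun v => ?_
  rw [← sub_eq_zero]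
  refine hBnd.1 _ fun w => ?_
  rw [map_sub, LinearMap.sub_apply, ← h', ← h'', sub_self]

/-- For an alternating `B`, a right adjoint is also a left adjoint: `B(Xv, w) = B(v, X†w)`.
[cite: Milne1999LefschetzClasses, §1 p. 642] -/
theorem bilin_apply_left_of_rightAdjoint (hBalt : B.IsAlt) {X X' : Module.End ℂ (complexBetti A.X 1)}
    (h : ∀ v w, B v (X w) = B (X' v) w) (v w : complexBetti A.X 1) : B (X v) w = B v (X' w) := by
  rw [← hBalt.neg_eq, h, hBalt.neg_eq]

/-- `X†† = X` for an alternating non-degenerate `B` (in the form: `X` is a right adjoint of `X†`). [cite: Milne1999LefschetzClasses, §1 p. 642 (`β ↦ β†` is an involution)] -/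
theorem rightAdjoint_rightAdjoint (hBalt : B.IsAlt) {X X' : Module.End ℂ (complexBetti A.X 1)}
    (h : ∀ v w, B v (X w) = B (X' v) w) (v w : complexBetti A.X 1) : B v (X' w) = B (X v) w :=
  (bilin_apply_left_of_rightAdjoint hBalt h v w).symm

/-- **An isometry of `B` commuting with `X` commutes with `X†`** (van Geemen 6.9 / Milne p. 643: `†` restricts to
`C(A)`). [cite: Milne1999LefschetzClasses, §1 p. 643] -/
theorem rightAdjoint_comm_of_isometry (hBnd : B.Nondegenerate) {X X' : Module.End ℂ (complexBetti A.X 1)}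
    (h : ∀ v w, B v (X w) = B (X' v) w) {u : complexBetti A.X 1 ≃ₗ[ℂ] complexBetti A.X 1}
    (hu : ∀ v w, B (u v) (u w) = B v w) (huX : ∀ v, u (X v) = X (u v)) (v : complexBetti A.X 1) :
    u (X' v) = X' (u v) := by
  rw [← sub_eq_zero]
  refine hBnd.1 _ fun w => ?_
  obtain ⟨w', rfl⟩ : ∃ w', w = u w' := ⟨u.symm w, (u.apply_symm_apply w).symm⟩
  rw [map_sub, LinearMap.sub_apply, sub_eq_zero]
  calc B (u (X' v)) (u w') = B (X' v) w' := hu _ _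
    _ = B v (X w') := (h v w').symm
    _ = B (u v) (u (X w')) := (hu _ _).symm
    _ = B (u v) (X (u w')) := by rw [huX]
    _ = B (X' (u v)) (u w') := h _ _

/-- **The bicommutant `E''` is `†`-stable**, for `B` non-degenerate alternating and preserved by the Hodge group: the
adjoint of `φ^*` commutes with `Hg(A)(ℂ)|_{H¹}` (which commutes with `φ^*` and preserves `B`), so lies in the span
of the pull-backs (Deligne I Prop. 3.4 + Riemann; the tree's road of `adjoint_pullbackOne_mem_span_pullbackOne`);
linearity and uniqueness of adjoints extend this to the span. "`C(A)` is stable under the involution `†` […]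
independent of the choice of `D`." [cite: Milne1999LefschetzClasses, §1 pp. 642–643] [cite: Deligne1982HodgeCycles, I §3 Prop. 3.4] -/
theorem rightAdjoint_mem_bicommutant (hBnd : B.Nondegenerate)
    (hBHg : ∀ g ∈ hodgeGroup A.dim A.X, ∀ v w : complexBetti A.X 1, B (g 1 v) (g 1 w) = B v w)
    {X X' : Module.End ℂ (complexBetti A.X 1)}
    (hX : X ∈ Subalgebra.centralizer ℂ (centralizerAlgebra A : Set (Module.End ℂ (complexBetti A.X 1))))
    (h : ∀ v w, B v (X w) = B (X' v) w) :
    X' ∈ Subalgebra.centralizer ℂ (centralizerAlgebra A : Set (Module.End ℂ (complexBetti A.X 1))) := by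
  rw [mem_bicommutant_iff_mem_span] at hX ⊢
  -- reduce to generators: the statement "every right adjoint of `X` is in the span", by span induction on `X`
  suffices key : ∀ Y ∈ Submodule.span ℂ (Set.range fun φ : A ⟶ A ↦ pullbackOne A φ),
      ∀ Y', (∀ v w, B v (Y w) = B (Y' v) w) → Y' ∈ Submodule.span ℂ (Set.range fun φ : A ⟶ A ↦ pullbackOne A φ) from
    key X hX X' h
  intro Y hY
  induction hY using Submodule.span_induction with
  | mem Y hY =>
    obtain ⟨φ, rfl⟩ := hY
    intro Y' hY'
    refine Deligne1982.mem_span_complexBetti_map_of_commute_hodgeGroup_of_riemann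
      deligneMilne1982_Thm_6_20_full_holds A Y' fun g hg v => ?_
    have hg1 : (g 1 : complexBetti A.X 1 ≃ₗ[ℂ] complexBetti A.X 1) ∈ centralizerGroup A :=
      hodgeGroupOne_le_centralizerGroup (mem_hodgeGroupOne_iff.2 ⟨g, hg, rfl⟩)
    exact (rightAdjoint_comm_of_isometry hBnd hY' (hBHg g hg) (fun v => (mem_centralizerGroup_iff.1 hg1) φ v) v).symm
  | zero =>
    intro Y' hY'
    have h0 : Y' = 0 := rightAdjoint_unique hBnd hY' (fun v w => by simp)
    rw [h0]
    exact zero_mem _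
  | add Y₁ Y₂ _ _ h₁ h₂ =>
    intro Y' hY'
    obtain ⟨Y₁', hY₁'⟩ := exists_rightAdjoint hBnd Y₁
    obtain ⟨Y₂', hY₂'⟩ := exists_rightAdjoint hBnd Y₂
    have e : Y' = Y₁' + Y₂' := rightAdjoint_unique hBnd hY' fun v w => by
      rw [LinearMap.add_apply, map_add, hY₁', hY₂', LinearMap.add_apply, map_add, LinearMap.add_apply]
    rw [e]
    exact add_mem (h₁ Y₁' hY₁') (h₂ Y₂' hY₂')
  | smul r Y _ hY =>
    intro Y' hY'
    obtain ⟨Y₁', hY₁'⟩ := exists_rightAdjoint hBnd Y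
    have e : Y' = r • Y₁' := rightAdjoint_unique hBnd hY' fun v w => by
      rw [LinearMap.smul_apply, map_smul, hY₁', LinearMap.smul_apply, map_smul, LinearMap.smul_apply]
    rw [e]
    exact Submodule.smul_mem _ r (hY Y₁' hY₁')

end Adjoint

/-! ### §7 Every `B`-symmetric element of `E''` is a contraction operator of a divisor class -/

section Main

variable {A : AbelianVariety ℂ} {B : LinearMap.BilinForm ℂ (complexBetti A.X 1)}

/-- **A polarization gives an INVERTIBLE contraction operator in `J`**: for `dim A ≥ 1` there is a class
`h₀ ∈ B¹(A) ⊗ ℂ` (the rational Kähler class of a projective embedding, `KaehlerRationalDatum`) with `T_{h₀}`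
bijective — `ι_•(h₀) : (H¹)^∨ → H¹` is onto because `h₀^{dim A} ≠ 0` (the tree's `exists_contraction_eq`) and `B♭`
is onto. [cite: LangeBirkenhake1992, §2.5 (non-degeneracy of the form of an ample class)] [cite: VoisinHodgeI2002, §3.1.3 Cor. 3.9] -/
theorem exists_mem_hodgeClassSpan_contractionOp_bijective (hn : 1 ≤ A.dim) (hBnd : B.Nondegenerate) :
    ∃ h₀ ∈ hodgeClassSpan A.dim A.X 1, Function.Bijective (contractionOp A B h₀) := by
  classical
  haveI : Module.Finite ℂ (complexBetti A.X 1) := abelianVarietyCohomologyExteriorH1_holds.finite_one A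
  obtain ⟨D⟩ := nonempty_kaehlerRationalDatum (AbelianVariety.isSmoothProjective_holds (A := A))
  have hQ : IsRationalClass D.Hη := D.isRationalClass_Hη
  have hK : IsKaehlerClass A.dim A.X D.Hη := D.isKaehlerClassVia.isKaehlerClass D.isNatural D.isMultiplicative
  have hh : D.Hη ∈ hodgeClassSpan A.dim A.X 1 :=
    Submodule.subset_span (show D.Hη ∈ {c : complexBetti A.X (2 * 1) | IsRationalClass c ∧
      IsOfHodgeType A.dim A.X (2 * 1) 1 1 c} from ⟨hQ, hK.isOfHodgeType_one_one⟩)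
  refine ⟨D.Hη, hh, ?_⟩
  let b := Module.finBasis ℂ (complexBetti A.X 1)
  have hrep := eq_sum_half_smul_cup_interiorTwo b D.Hη
  have hpow : cupPowTwo (∑ i, (2 : ℂ)⁻¹ • cupProduct (rfl : 1 + 1 = 2) (interiorTwo A (b.coord i) D.Hη) (b i)) A.dim ≠ 0 := by
    rw [← hrep]
    exact hK.cupPowTwo_ne_zero (AbelianVariety.isSmoothProjective_holds (A := A)) hn le_rfl
  -- surjectivity of `T_{h₀} = ι_•(h₀) ∘ B♭`
  have hsurj : Function.Surjective (contractionOp A B D.Hη) := by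
    intro x
    obtain ⟨μ, hμ⟩ := exists_contraction_eq (fun _ => (2 : ℂ)⁻¹) (fun i => interiorTwo A (b.coord i) D.Hη) (fun i => b i)
      hpow x
    obtain ⟨v, hv⟩ := (B.toDual hBnd).surjective μ
    have hv2 : B v = μ := LinearMap.ext fun n => by rw [← hv, LinearMap.BilinForm.toDual_def]
    refine ⟨v, ?_⟩
    rw [contractionOp_apply, hv2, hrep, interiorTwo_sum_smul_cupProduct]
    exact hμ
  exact ⟨(LinearMap.injective_iff_surjective).2 hsurj, hsurj⟩

/-- **Milne 1999 Prop. 1.3 / Prop. 3.3 on the carriers — every `B`-symmetric element of the bicommutant `E''` of the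
`φ^*` is the contraction operator of a class in `B¹(A) ⊗ ℂ`.** For a complex abelian variety `A` of positive
dimension and a non-degenerate alternating scalar form `B` on `H¹(A(ℂ); ℂ)` preserved by the Hodge group (e.g.
`B = λ ∘ Q_h`): if `S ∈ E''` satisfies `B(Sv, w) = B(v, Sw)` then `S = T_c` for some `c ∈ B¹(A) ⊗ ℂ` ("the
`k`-bilinear forms `ψ` with `ψ(γx, y) = ψ(x, γ†y)` for all `γ ∈ C(A)` are exactly the combinations of the `e_D`";
`NS(A) ⊗ k ≅ (End⁰(A) ⊗ k)^{sym}`). PROOF (no Néron–Severi group): `J = T(B¹ ⊗ ℂ) ≤ E''` is stable under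
`T ↦ XT + TX†`, `X ∈ E''` (`contractionOp_derivTwo`, `derivTwo_mem_hodgeClassSpan_of_mem_span`,
`rightAdjoint_mem_bicommutant`), and contains an invertible `T₀ = T_{h₀}`
(`exists_mem_hodgeClassSpan_contractionOp_bijective`); `T₀` is `B`-symmetric, so is `T₀⁻¹ ∈ E''`, and with
`X = S T₀⁻¹`: `XT₀ + T₀X† = 2S`. [cite: Milne1999LefschetzClasses, §1 Prop. 1.3 and §3 Prop. 3.3]
[cite: MumfordAV1970, §21 Application III] [cite: LangeBirkenhake1992, Prop. 5.2.1] -/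
theorem exists_mem_hodgeClassSpan_contractionOp_eq (hn : 1 ≤ A.dim) (hBalt : B.IsAlt) (hBnd : B.Nondegenerate)
    (hBHg : ∀ g ∈ hodgeGroup A.dim A.X, ∀ v w : complexBetti A.X 1, B (g 1 v) (g 1 w) = B v w)
    {S : Module.End ℂ (complexBetti A.X 1)}
    (hS : S ∈ Subalgebra.centralizer ℂ (centralizerAlgebra A : Set (Module.End ℂ (complexBetti A.X 1))))
    (hSsym : ∀ v w, B (S v) w = B v (S w)) :
    ∃ c ∈ hodgeClassSpan A.dim A.X 1, contractionOp A B c = S := by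
  haveI : Module.Finite ℂ (complexBetti A.X 1) := abelianVarietyCohomologyExteriorH1_holds.finite_one A
  set E := Subalgebra.centralizer ℂ (centralizerAlgebra A : Set (Module.End ℂ (complexBetti A.X 1))) with hE
  set J : Submodule ℂ (Module.End ℂ (complexBetti A.X 1)) := (hodgeClassSpan A.dim A.X 1).map (contractionOp A B)
    with hJ
  -- (1) closure of `J` under `T ↦ XT + TX†`, `X ∈ E''`
  have hclos : ∀ X ∈ E, ∀ X', (∀ v w, B v (X w) = B (X' v) w) → ∀ T ∈ J, X * T + T * X' ∈ J := by
    intro X hX X' hX' T hT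
    obtain ⟨c, hc, rfl⟩ := Submodule.mem_map.1 hT
    rw [← contractionOp_derivTwo hX' c]
    exact Submodule.mem_map_of_mem (derivTwo_mem_hodgeClassSpan_of_mem_span (mem_bicommutant_iff_mem_span.1 hX) hc)
  -- (2) an invertible symmetric `T₀ ∈ J`
  obtain ⟨h₀, hh₀, hbij⟩ := exists_mem_hodgeClassSpan_contractionOp_bijective (B := B) hn hBnd
  set T₀ := contractionOp A B h₀ with hT₀
  let e₀ : complexBetti A.X 1 ≃ₗ[ℂ] complexBetti A.X 1 := LinearEquiv.ofBijective T₀ hbij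
  have he₀ : ∀ v, e₀ v = T₀ v := fun v => rfl
  set T₀inv : Module.End ℂ (complexBetti A.X 1) := (e₀.symm : complexBetti A.X 1 →ₗ[ℂ] complexBetti A.X 1) with hT₀inv
  have hinv₁ : T₀ * T₀inv = 1 := by
    refine LinearMap.ext fun v => ?_
    rw [Module.End.mul_apply, hT₀inv, LinearEquiv.coe_coe, ← he₀, e₀.apply_symm_apply]; rfl
  have hinv₂ : T₀inv * T₀ = 1 := by
    refine LinearMap.ext fun v => ?_
    rw [Module.End.mul_apply, hT₀inv, LinearEquiv.coe_coe, ← he₀, e₀.symm_apply_apply]; rfl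
  have hT₀E : T₀ ∈ E := contractionOp_mem_bicommutant hn hBHg hh₀
  have hT₀sym : ∀ v w, B (T₀ v) w = B v (T₀ w) := bilin_contractionOp_apply hBalt h₀
  -- `T₀⁻¹ ∈ E''` (centralisers are inverse-closed) and `T₀⁻¹` is symmetric
  have hT₀invE : T₀inv ∈ E := by
    rw [hE, Subalgebra.mem_centralizer_iff]
    intro g hg
    have hc := (Subalgebra.mem_centralizer_iff ℂ).1 hT₀E g hg
    calc g * T₀inv = T₀inv * T₀ * g * T₀inv := by rw [hinv₂, one_mul]
      _ = T₀inv * (T₀ * g) * T₀inv := by simp only [mul_assoc]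
      _ = T₀inv * (g * T₀) * T₀inv := by rw [hc]
      _ = T₀inv * g * (T₀ * T₀inv) := by simp only [mul_assoc]
      _ = T₀inv * g := by rw [hinv₁, mul_one]
  have hT₀invsym : ∀ v w, B v (T₀inv w) = B (T₀inv v) w := by
    intro v w
    have e1 : v = T₀ (T₀inv v) := by
      have := LinearMap.congr_fun hinv₁ v; rw [Module.End.mul_apply, Module.End.one_apply] at this; exact this.symm
    have e2 : w = T₀ (T₀inv w) := by
      have := LinearMap.congr_fun hinv₁ w; rw [Module.End.mul_apply, Module.End.one_apply] at this; exact this.symm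
    conv_lhs => rw [e1]
    conv_rhs => rw [e2]
    rw [hT₀sym]
  -- (3) `X = S T₀⁻¹ ∈ E''` with adjoint `T₀⁻¹ S`: `X T₀ + T₀ X† = 2 S ∈ J`
  have hX : S * T₀inv ∈ E := Subalgebra.mul_mem _ hS hT₀invE
  have hX' : ∀ v w, B v ((S * T₀inv) w) = B ((T₀inv * S) v) w := by
    intro v w
    rw [Module.End.mul_apply, Module.End.mul_apply, ← hSsym, hT₀invsym]
  have hT₀J : T₀ ∈ J := Submodule.mem_map_of_mem hh₀
  have h2S := hclos _ hX _ hX' T₀ hT₀J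
  have e2S : S * T₀inv * T₀ + T₀ * (T₀inv * S) = (2 : ℂ) • S := by
    rw [mul_assoc, hinv₂, mul_one, ← mul_assoc, hinv₁, one_mul, two_smul]
  rw [e2S] at h2S
  have hSJ : S ∈ J := by
    have := Submodule.smul_mem J ((2 : ℂ)⁻¹) h2S
    rwa [smul_smul, inv_mul_cancel₀ two_ne_zero, one_smul] at this
  obtain ⟨c, hc, hcS⟩ := Submodule.mem_map.1 hSJ
  exact ⟨c, hc, hcS⟩

/-- **The dictionary: `c ∈ B¹(A) ⊗ ℂ ⟺ T_c ∈ E''`** (the bicommutant of the `φ^*`, `= End⁰(A) ⊗ ℂ` acting), for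
`dim A ≥ 1` and a non-degenerate alternating `B` preserved by the Hodge group: Lefschetz `(1,1)` classes of a
complex abelian variety correspond exactly to the `B`-symmetric elements of `End⁰(A) ⊗ ℂ` (Milne Prop. 1.3 /
Prop. 3.3; Mumford §21: `NS⁰(A) ≅ End⁰(A)^{sym}`). [cite: Milne1999LefschetzClasses, §1 Prop. 1.3 and §3 Prop. 3.3]
[cite: MumfordAV1970, §21 Application III] -/
theorem mem_hodgeClassSpan_one_iff_contractionOp_mem_bicommutant (hn : 1 ≤ A.dim) (hBalt : B.IsAlt)
    (hBnd : B.Nondegenerate)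
    (hBHg : ∀ g ∈ hodgeGroup A.dim A.X, ∀ v w : complexBetti A.X 1, B (g 1 v) (g 1 w) = B v w)
    (c : complexBetti A.X 2) :
    c ∈ hodgeClassSpan A.dim A.X 1 ↔
      contractionOp A B c ∈ Subalgebra.centralizer ℂ (centralizerAlgebra A : Set (Module.End ℂ (complexBetti A.X 1))) := by
  refine ⟨contractionOp_mem_bicommutant hn hBHg, fun hT => ?_⟩
  obtain ⟨c', hc', he⟩ := exists_mem_hodgeClassSpan_contractionOp_eq hn hBalt hBnd hBHg hT
    (bilin_contractionOp_apply hBalt c)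
  rwa [← contractionOp_injective hBnd he]

/-- **The form used downstream (Milne Prop. 3.3, "degree-`2` invariants are divisor classes")**: a `2`-vector
`c = Σ_l a_l x_l ⌣ y_l ∈ H²(A(ℂ); ℂ)` whose contraction operator `v ↦ Σ_l a_l (B(v, y_l) x_l − B(v, x_l) y_l)` commutes
with every element of `C(A) ⊗ ℂ = centralizerAlgebra A` lies in `B¹(A) ⊗ ℂ = hodgeClassSpan A.dim A.X 1`, hence is a
divisor class (`divisorClassesSpan A.X A.dim 1`). [cite: Milne1999LefschetzClasses, §3 Prop. 3.3 and Thm. 3.2] -/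
theorem sum_smul_cupProduct_mem_hodgeClassSpan_of_forall_comm {ι : Type*} [Fintype ι] (hn : 1 ≤ A.dim)
    (hBalt : B.IsAlt) (hBnd : B.Nondegenerate)
    (hBHg : ∀ g ∈ hodgeGroup A.dim A.X, ∀ v w : complexBetti A.X 1, B (g 1 v) (g 1 w) = B v w)
    (a : ι → ℂ) (x y : ι → complexBetti A.X 1) {T : Module.End ℂ (complexBetti A.X 1)}
    (hT : ∀ v, T v = ∑ l, a l • (B v (y l) • x l - B v (x l) • y l))
    (hcomm : ∀ S ∈ centralizerAlgebra A, S * T = T * S) :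
    (∑ l, a l • cupProduct (rfl : 1 + 1 = 2) (x l) (y l)) ∈ hodgeClassSpan A.dim A.X 1 := by
  rw [mem_hodgeClassSpan_one_iff_contractionOp_mem_bicommutant hn hBalt hBnd hBHg]
  have e : contractionOp A B (∑ l, a l • cupProduct (rfl : 1 + 1 = 2) (x l) (y l)) = T :=
    LinearMap.ext fun v => by rw [contractionOp_sum_smul_cupProduct_apply, hT]
  rw [e, Subalgebra.mem_centralizer_iff]
  exact hcomm

end Main

/-! ### §8 The scalar forms `B = λ ∘ Q_h` of a class `h ∈ B¹(A) ⊗ ℂ` with non-degenerate `Q_h` -/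

section Polarization

variable {A : AbelianVariety ℂ} {h : complexBetti A.X 2}

/-- **A Hodge-invariant non-degenerate alternating scalar form on `H¹(A(ℂ); ℂ)`** from a class `h ∈ B¹(A) ⊗ ℂ` with
non-degenerate polarization pairing `Q_h(x, y) = h^{dim A - 1} ⌣ x ⌣ y`: `B = λ ∘ Q_h` for an injective functional `λ`
on the top-degree line (the tree's `exists_bilinForm_isAlt_nondegenerate`); `Hg(A)(ℂ)|_{H¹}` preserves `Q_h`
(`hodgeGroupOne_le_unitaryCentralizerGroup`), hence `B`, and `u` preserves `Q_h` iff it preserves `B`.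
[cite: Milne1999LefschetzClasses, §1 p. 644 and §4 p. 660] [cite: LangeBirkenhake1992, Lemma 1.1.17 and Lemma 1.7.4] -/
theorem exists_hodgeInvariant_bilinForm (hh : h ∈ hodgeClassSpan A.dim A.X 1)
    (hnd : ∀ x : complexBetti A.X 1, (∀ y, polarizationPairingOne A.X h (A.dim - 1) x y = 0) → x = 0) :
    ∃ B : LinearMap.BilinForm ℂ (complexBetti A.X 1), B.IsAlt ∧ B.Nondegenerate ∧
      (∀ g ∈ hodgeGroup A.dim A.X, ∀ v w : complexBetti A.X 1, B (g 1 v) (g 1 w) = B v w) ∧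
      ∀ u : complexBetti A.X 1 ≃ₗ[ℂ] complexBetti A.X 1,
        (∀ v w, polarizationPairingOne A.X h (A.dim - 1) (u v) (u w) = polarizationPairingOne A.X h (A.dim - 1) v w) ↔
          ∀ v w, B (u v) (u w) = B v w := by
  obtain ⟨B, hBalt, hBnd, lam, hlam, hB⟩ := exists_bilinForm_isAlt_nondegenerate (A := A) hnd
  refine ⟨B, hBalt, hBnd, fun g hg v w => ?_, fun u => ⟨fun hu v w => by rw [hB, hB, hu], fun hu v w => ?_⟩⟩
  · rw [hB, hB, (hodgeGroupOne_le_unitaryCentralizerGroup hh (mem_hodgeGroupOne_iff.2 ⟨g, hg, rfl⟩)).2 v w]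
  · exact hlam (by rw [← hB, ← hB, hu])

/-- The `S(A)(ℂ)`-form of the dictionary: for `h ∈ B¹(A) ⊗ ℂ` with `Q_h` non-degenerate and `B = λ ∘ Q_h` as above,
`u ∈ unitaryCentralizerGroup A h` iff `u` commutes with the `φ^*` and preserves `B`. [cite: Milne1999LefschetzClasses, §1 p. 644] -/
theorem mem_unitaryCentralizerGroup_iff_of_bilinForm {B : LinearMap.BilinForm ℂ (complexBetti A.X 1)}
    (hB : ∀ u : complexBetti A.X 1 ≃ₗ[ℂ] complexBetti A.X 1,
      (∀ v w, polarizationPairingOne A.X h (A.dim - 1) (u v) (u w) = polarizationPairingOne A.X h (A.dim - 1) v w) ↔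
        ∀ v w, B (u v) (u w) = B v w)
    (u : complexBetti A.X 1 ≃ₗ[ℂ] complexBetti A.X 1) :
    u ∈ unitaryCentralizerGroup A h ↔ u ∈ centralizerGroup A ∧ ∀ v w, B (u v) (u w) = B v w := by
  rw [mem_unitaryCentralizerGroup_iff, hB u]

end Polarization

end Literature.AlgebraicGeometry.Milne1999

end
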